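/-
Copyright (c) 2026 the pub-hodgecm-mathlib formalisation cell (harness21).  Prover seat hodgecm-mathlib-K2E3-p03 (g4), Track B «K2-LIT» ∕ h413
(`stmt-HodgeConjecture-24833`), line `K2_E3_EllipticInputs`, unit U12, §L leaf (LBGL-ge3) at `N = 3` (Richardson road), brick R′ of the (F-E) road memo
`K2/K2E3-p11/g4/MEMO-FE-ParabolicSliceDensity.v1.K2E3-p11-g4.md` §2 — PART 3: THE VALUATIONS `v(χ_Y′(λ))` AT THE RATIONAL ROOTS `λ` OF `χ_Y` FORM A
LOCALLY CONSTANT MULTISET ON THE REGULAR SEMISIMPLE SET `{disc ≠ 0}` (the root-by-root bookkeeping behind `W_𝔭 = c · Σ_λ ‖χ′(λ)‖⁻¹`).  2026-09-04.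
-/
import Summits.HodgeConjecture.HodgeConjecture.Theorems.K2E3CubicRationalRootsLocallyConstant   -- ★ PARTS 1–2 (this seat): root count locally constant, the toolkit
import HarnessLib

/-!
# K2_E3 road (h413), §L leaf (LBGL-ge3) at `N = 3`, brick R′ (part 3) — `v(χ_Y′)` at the rational roots of `χ_Y` is a locally constant multiset on `{disc ≠ 0}`

Cell `pub/hodgecm-mathlib` (D-0151), Track B (21-frontier RULING «PUSH BOTH» 2026-09-03, director req624), seat K2E3-p03 (g4) (free E3 hand; brick R′
«HAND WANTED #3» of the (F-E) road — ROAD v2 of the owner K2E3-p11 (g5) 2026-09-04T05:41:53Z: «H″ consumes R′ UNCHANGED», `W_𝔭 = c·Σ_j ‖χ(M_j)‖⁻¹`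
summed over the rational roots; dealer K2E3-plan (g3)).  `--supports stmt-HodgeConjecture-24833 --as helper`; THEOREMS ONLY (no definition ∕ instance ∕
notation ∕ named fact ∕ `sorry`); never imports `Cruxes/…/Lines`.  COUNT-NEUTRAL: (LBGL-ge3) `sig_K2E3GLnNilpotentFourierRegularGeThree` stays OPEN.

THE RESULT (`F` ANY non-archimedean local field; `v` the valuation of the valuative relation; `Polynomial.roots` = the multiset of `F`-rational roots).
For `X₀ ∈ 𝔤𝔩₃(F)` with `disc χ_{X₀} ≠ 0`:
* `exists_radius_eventually_roots_near` — ONE radius `ρ` (below every root separation `v(λ − λ′)` and with `ρ² ≤ v(χ₀′(λ))`) such that for `Y` near `X₀`: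
  every rational root of `χ_Y` is `ρ`-close to a rational root of `χ₀` (NO NEW ROOTS), every rational root `λ` of `χ₀` has a rational root of `χ_Y`
  `ρ`-close to it (PERSISTENCE), and `v(χ_Y′(y)) = v(χ₀′(λ))` on `B(λ, ρ)` (DERIVATIVE CONSTANCY) — the common data of PART 2's count and of this file;
* **`eventually_map_valuation_derivative_roots_charpoly_eq`** — `∀ᶠ Y in 𝓝 X₀, χ_Y.roots.map (v ∘ χ_Y′) = χ_{X₀}.roots.map (v ∘ χ_{X₀}′)` (multisets);
* **`eventually_map_normAbs_derivative_roots_charpoly_eq`** — the same with the normalised absolute value `‖·‖_F = normAbs F`;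
* **`eventually_sum_inv_normAbs_derivative_roots_charpoly_eq`** — `Σ_{λ ∈ roots χ_Y} ‖χ_Y′(λ)‖_F⁻¹ = Σ_{λ ∈ roots χ_{X₀}} ‖χ_{X₀}′(λ)‖_F⁻¹` (in `ℝ`) near `X₀`:
  the local constancy clause of `W_𝔭` on `{disc ≠ 0}`.
PROOF.  PART 2's `eventually_card_roots_charpoly_eq` fixes `r := card roots ∈ {0, 1, 3}`; `r = 0`: both multisets empty; `r = 1`: the one root `μ` of `χ_Y` lies
in `B(λ, ρ)`, so `v(χ_Y′(μ)) = v(χ₀′(λ))`; `r = 3`: persistence gives roots `μ_i ∈ B(λ_i, ρ)` of `χ_Y`, pairwise distinct (the balls are disjoint), hence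
`χ_Y.roots = {μ₁, μ₂, μ₃}` (`Multiset.eq_of_le_of_card_le`) and `v(χ_Y′(μ_i)) = v(χ₀′(λ_i))` termwise.
[HarishChandra1999AdmissibleDistributions, §7; Cassels1986, Ch. 4 §3 Cor. 2 (continuity of roots)]
HONEST LABEL: HC_CM is proved only modulo the 7 printed citations (2 remaining named inputs: hLiu418 = stmt-HodgeConjecture-24832, h413 =
stmt-HodgeConjecture-24833) until rung 0 closes; count-neutral helper.

## References
* [HarishChandra1999AdmissibleDistributions] Harish-Chandra (DeBacker–Sally), *Admissible Invariant Distributions on Reductive p-adic Groups* (1999), §7.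
* [Cassels1986] J. W. S. Cassels, *Local Fields*, LMS Student Texts 3 (1986), Ch. 4 §3 Cor. 2.
-/

set_option autoImplicit false
set_option linter.dupNamespace false   -- `Summit.HodgeConjecture.HodgeConjecture.…` (D-0017 nested layout; lakefile exemption for Summits)

noncomputable section

open Filter Topology Set Polynomial
open scoped Matrix NNReal
open ValuativeRel
open Summit.HodgeConjecture.HodgeConjecture.Cruxes.H413.K2E3CharpolyRootsPerturbation
open Summit.HodgeConjecture.HodgeConjecture.Cruxes.H413.K2E3CubicRationalRootsLocallyConstant
open Literature.NumberTheory.GaloisRepresentations.IsNonarchimedeanLocalField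

namespace Summit.HodgeConjecture.HodgeConjecture.Cruxes.H413.K2E3CubicRootDerivativeValuations

variable {F : Type*} [Field F] [ValuativeRel F] [TopologicalSpace F] [IsNonarchimedeanLocalField F]

/-- **One radius for everything.**  For `X₀ ∈ 𝔤𝔩₃(F)` with `disc χ_{X₀} ≠ 0` there is `ρ` with: `ρ ≤ v(λ − λ′)` for distinct rational roots `λ ≠ λ′` of `χ₀`,
`ρ·ρ ≤ v(χ₀′(λ))` at every rational root, and for `Y` near `X₀`: (no new roots) every rational root of `χ_Y` is `ρ`-close to a rational root of `χ₀`;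
(persistence) every rational root of `χ₀` has a rational root of `χ_Y` `ρ`-close to it; (derivative constancy) `v(χ_Y′(y)) = v(χ₀′(λ))` for `v(y − λ) < ρ`.
[cite: Cassels1986, Ch. 4 §3 Cor. 2] -/
theorem exists_radius_eventually_roots_near (X₀ : Matrix (Fin 3) (Fin 3) F) (hD : X₀.charpoly.discr ≠ 0) :
    ∃ ρ : (ValueGroupWithZero F)ˣ,
      (∀ x ∈ X₀.charpoly.roots, ∀ x' ∈ X₀.charpoly.roots, x ≠ x' → (ρ : ValueGroupWithZero F) ≤ valuation F (x - x')) ∧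
      (∀ x ∈ X₀.charpoly.roots, (ρ : ValueGroupWithZero F) * ρ ≤ valuation F (X₀.charpoly.derivative.eval x)) ∧
      ∀ᶠ Y in 𝓝 X₀,
        (∀ μ, Y.charpoly.IsRoot μ → ∃ x ∈ X₀.charpoly.roots, valuation F (μ - x) < ρ) ∧
        (∀ x ∈ X₀.charpoly.roots, ∃ μ, Y.charpoly.IsRoot μ ∧ valuation F (μ - x) < ρ) ∧
        (∀ x ∈ X₀.charpoly.roots, ∀ y, valuation F (y - x) < ρ →
          valuation F (Y.charpoly.derivative.eval y) = valuation F (X₀.charpoly.derivative.eval x)) := by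
  classical
  have hmon : X₀.charpoly.Monic := Matrix.charpoly_monic X₀
  have hdeg : X₀.charpoly.natDegree = 3 := by rw [Matrix.charpoly_natDegree_eq_dim, Fintype.card_fin]
  have hχ0 : X₀.charpoly ≠ 0 := hmon.ne_zero
  have hsep : X₀.charpoly.Separable := separable_of_discr_ne_zero hmon (by omega) hD
  have hmemS : ∀ x, x ∈ X₀.charpoly.roots.toFinset ↔ X₀.charpoly.IsRoot x := fun x => by rw [Multiset.mem_toFinset, mem_roots hχ0]
  have hδ : ∀ x ∈ X₀.charpoly.roots.toFinset, X₀.charpoly.derivative.eval x ≠ 0 := by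
    intro x hx
    have h := hsep.eval₂_derivative_ne_zero (RingHom.id F) (x := x) ((hmemS x).1 hx)
    simpa using h
  have hrad : ∀ x ∈ X₀.charpoly.roots.toFinset, ∃ ρ : (ValueGroupWithZero F)ˣ, ∀ᶠ Y in 𝓝 X₀, ∀ y, valuation F (y - x) < ρ →
      valuation F (Y.charpoly.derivative.eval y) = valuation F (X₀.charpoly.derivative.eval x) :=
    fun x hx => exists_eventually_forall_valuation_derivative_eval_eq X₀ (hδ x hx)
  choose! ρd hρd using hrad
  obtain ⟨ρA, hρA⟩ := exists_units_le_of_finset X₀.charpoly.roots.toFinset ρd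
  obtain ⟨ρB, hρB⟩ := exists_units_le_of_finset X₀.charpoly.roots.toFinset (fun x =>
    if hx : X₀.charpoly.derivative.eval x ≠ 0 then Units.mk0 (valuation F (X₀.charpoly.derivative.eval x)) ((Valuation.ne_zero_iff _).2 hx) else 1)
  obtain ⟨ρC, hρC⟩ := exists_units_le_of_finset (X₀.charpoly.roots.toFinset ×ˢ X₀.charpoly.roots.toFinset) (fun q =>
    if hq : q.1 ≠ q.2 then Units.mk0 (valuation F (q.1 - q.2)) ((Valuation.ne_zero_iff _).2 (sub_ne_zero.2 hq)) else 1)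
  obtain ⟨ρ, hρA', hρB', hρC', hρ1⟩ : ∃ ρ : (ValueGroupWithZero F)ˣ, ρ ≤ ρA ∧ ρ ≤ ρB ∧ ρ ≤ ρC ∧ ρ ≤ 1 :=
    ⟨min (min ρA ρB) (min ρC 1), (min_le_left _ _).trans (min_le_left _ _), (min_le_left _ _).trans (min_le_right _ _),
      (min_le_right _ _).trans (min_le_left _ _), (min_le_right _ _).trans (min_le_right _ _)⟩
  have hρ1' : (ρ : ValueGroupWithZero F) ≤ 1 := by
    have h := Units.val_le_val.2 hρ1
    rwa [Units.val_one] at h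
  have hρδ : ∀ x ∈ X₀.charpoly.roots.toFinset, (ρ : ValueGroupWithZero F) * ρ ≤ valuation F (X₀.charpoly.derivative.eval x) := by
    intro x hx
    have hB := hρB x hx
    rw [dif_pos (hδ x hx)] at hB
    have h : (ρ : ValueGroupWithZero F) ≤ valuation F (X₀.charpoly.derivative.eval x) := Units.val_le_val.2 (hρB'.trans hB)
    calc (ρ : ValueGroupWithZero F) * ρ ≤ ρ * 1 := mul_le_mul le_rfl hρ1' zero_le zero_le
      _ ≤ valuation F (X₀.charpoly.derivative.eval x) := by rw [mul_one]; exact h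
  have hρsep : ∀ x ∈ X₀.charpoly.roots.toFinset, ∀ x' ∈ X₀.charpoly.roots.toFinset, x ≠ x' →
      (ρ : ValueGroupWithZero F) ≤ valuation F (x - x') := by
    intro x hx x' hx' hne
    have hC := hρC (x, x') (Finset.mk_mem_product hx hx')
    rw [dif_pos (show (x, x').1 ≠ (x, x').2 from hne)] at hC
    exact Units.val_le_val.2 (hρC'.trans hC)
  have hUo : IsOpen (⋃ x ∈ X₀.charpoly.roots.toFinset, {y : F | valuation F (y - x) < ρ}) :=
    isOpen_biUnion fun x _ => isOpen_setOf_valuation_sub_lt x ρ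
  have hUroots : ∀ x, X₀.charpoly.IsRoot x → x ∈ ⋃ x' ∈ X₀.charpoly.roots.toFinset, {y : F | valuation F (y - x') < ρ} := by
    intro x hx
    refine Set.mem_biUnion ((hmemS x).2 hx) ?_
    show valuation F (x - x) < ρ
    rw [sub_self, map_zero]
    exact ρ.zero_lt
  have E1 : ∀ᶠ Y in 𝓝 X₀, ∀ μ, Y.charpoly.IsRoot μ → ∃ x ∈ X₀.charpoly.roots.toFinset, valuation F (μ - x) < ρ := by
    filter_upwards [eventually_forall_isRoot_mem X₀ hUo hUroots] with Y hY μ hμ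
    have h := hY μ hμ
    simp only [Set.mem_iUnion, Set.mem_setOf_eq, exists_prop] at h
    exact h
  have E2 : ∀ᶠ Y in 𝓝 X₀, ∀ x ∈ X₀.charpoly.roots.toFinset, ∃ μ, Y.charpoly.IsRoot μ ∧ valuation F (μ - x) < ρ :=
    (Filter.eventually_all_finset _).2 fun x hx => eventually_exists_isRoot_valuation_sub_lt X₀ ((hmemS x).1 hx) (hδ x hx) ρ
  have E3 : ∀ᶠ Y in 𝓝 X₀, ∀ x ∈ X₀.charpoly.roots.toFinset, ∀ y, valuation F (y - x) < ρ →
      valuation F (Y.charpoly.derivative.eval y) = valuation F (X₀.charpoly.derivative.eval x) := by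
    refine (Filter.eventually_all_finset _).2 fun x hx => ?_
    filter_upwards [hρd x hx] with Y hY y hy
    exact hY y (lt_of_lt_of_le hy (Units.val_le_val.2 (hρA'.trans (hρA x hx))))
  have hfs : ∀ x, x ∈ X₀.charpoly.roots.toFinset ↔ x ∈ X₀.charpoly.roots := fun x => Multiset.mem_toFinset
  refine ⟨ρ, fun x hx x' hx' hne => hρsep x ((hfs x).2 hx) x' ((hfs x').2 hx') hne, fun x hx => hρδ x ((hfs x).2 hx), ?_⟩
  filter_upwards [E1, E2, E3] with Y h1 h2 h3
  refine ⟨fun μ hμ => ?_, fun x hx => h2 x ((hfs x).2 hx), fun x hx => h3 x ((hfs x).2 hx)⟩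
  obtain ⟨x, hx, hlt⟩ := h1 μ hμ
  exact ⟨x, (hfs x).1 hx, hlt⟩

/-- **R′ (E1): the multiset `{v(χ_Y′(λ)) : λ ∈ F, χ_Y(λ) = 0}` is locally constant on `{disc ≠ 0}`.**  For `X₀ ∈ 𝔤𝔩₃(F)` with `disc χ_{X₀} ≠ 0` and all `Y`
near `X₀`: `χ_Y.roots.map (v ∘ χ_Y′) = χ_{X₀}.roots.map (v ∘ χ_{X₀}′)`.  [cite: Cassels1986, Ch. 4 §3 Cor. 2] [cite: HarishChandra1999AdmissibleDistributions, §7] -/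
theorem eventually_map_valuation_derivative_roots_charpoly_eq (X₀ : Matrix (Fin 3) (Fin 3) F) (hD : X₀.charpoly.discr ≠ 0) :
    ∀ᶠ Y in 𝓝 X₀, Y.charpoly.roots.map (fun μ => valuation F (Y.charpoly.derivative.eval μ)) =
      X₀.charpoly.roots.map (fun x => valuation F (X₀.charpoly.derivative.eval x)) := by
  classical
  have hmon : X₀.charpoly.Monic := Matrix.charpoly_monic X₀
  have hdeg : X₀.charpoly.natDegree = 3 := by rw [Matrix.charpoly_natDegree_eq_dim, Fintype.card_fin]
  have hχ0 : X₀.charpoly ≠ 0 := hmon.ne_zero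
  have hsep : X₀.charpoly.Separable := separable_of_discr_ne_zero hmon (by omega) hD
  have hdegY : ∀ Y : Matrix (Fin 3) (Fin 3) F, Y.charpoly.natDegree = 3 := fun Y => by
    rw [Matrix.charpoly_natDegree_eq_dim, Fintype.card_fin]
  have hY0 : ∀ Y : Matrix (Fin 3) (Fin 3) F, Y.charpoly ≠ 0 := fun Y => (Matrix.charpoly_monic Y).ne_zero
  obtain ⟨ρ, hρsep, -, hev⟩ := exists_radius_eventually_roots_near X₀ hD
  filter_upwards [hev, eventually_card_roots_charpoly_eq X₀ hD] with Y hY hcard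
  obtain ⟨h1, h2, h3⟩ := hY
  have hcardS : X₀.charpoly.roots.card ≤ 3 := by have h := card_roots' X₀.charpoly; rwa [hdeg] at h
  have hS2 : X₀.charpoly.roots.card ≠ 2 := card_roots_ne_two_of_natDegree_eq_three hdeg
  rcases Nat.lt_or_ge X₀.charpoly.roots.card 1 with h0 | h1'
  · -- no roots on either side
    have hS0 : X₀.charpoly.roots = 0 := Multiset.card_eq_zero.1 (by omega)
    have hT0 : Y.charpoly.roots = 0 := Multiset.card_eq_zero.1 (by rw [hcard]; omega)
    rw [hS0, hT0, Multiset.map_zero, Multiset.map_zero]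
  rcases Nat.lt_or_ge X₀.charpoly.roots.card 2 with h1'' | h2'
  · -- one root `x` of `χ₀`, one root `μ` of `χ_Y`, and `μ ∈ B(x, ρ)`
    have hS1 : X₀.charpoly.roots.card = 1 := by omega
    obtain ⟨x, hSx⟩ := Multiset.card_eq_one.1 hS1
    obtain ⟨μ, hTμ⟩ := Multiset.card_eq_one.1 (hcard.trans hS1)
    have hxS : x ∈ X₀.charpoly.roots := by rw [hSx]; exact Multiset.mem_singleton_self x
    have hμroot : Y.charpoly.IsRoot μ := (mem_roots (hY0 Y)).1 (by rw [hTμ]; exact Multiset.mem_singleton_self μ)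
    obtain ⟨x', hx', hlt⟩ := h1 μ hμroot
    have hx'x : x' = x := by
      rw [hSx, Multiset.mem_singleton] at hx'
      exact hx'
    rw [hx'x] at hlt
    rw [hSx, hTμ, Multiset.map_singleton, Multiset.map_singleton, h3 x hxS μ hlt]
  · -- three roots: persistence in three disjoint balls
    have hS3 : X₀.charpoly.roots.card = 3 := by omega
    obtain ⟨x₁, x₂, x₃, hS123⟩ := Multiset.card_eq_three.1 hS3
    have hnd : x₁ ≠ x₂ ∧ x₁ ≠ x₃ ∧ x₂ ≠ x₃ := by
      have h := nodup_roots hsep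
      rw [hS123] at h
      simp only [Multiset.insert_eq_cons, Multiset.nodup_cons, Multiset.mem_cons, Multiset.mem_singleton, Multiset.nodup_singleton,
        not_or, and_true] at h
      exact ⟨h.1.1, h.1.2, h.2⟩
    have hx₁ : x₁ ∈ X₀.charpoly.roots := by rw [hS123]; simp
    have hx₂ : x₂ ∈ X₀.charpoly.roots := by rw [hS123]; simp
    have hx₃ : x₃ ∈ X₀.charpoly.roots := by rw [hS123]; simp
    obtain ⟨μ₁, hμ₁, hμ₁x⟩ := h2 x₁ hx₁
    obtain ⟨μ₂, hμ₂, hμ₂x⟩ := h2 x₂ hx₂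
    obtain ⟨μ₃, hμ₃, hμ₃x⟩ := h2 x₃ hx₃
    have hsep' : ∀ {μ μ' y y' : F}, y ∈ X₀.charpoly.roots → y' ∈ X₀.charpoly.roots → y ≠ y' →
        valuation F (μ - y) < ρ → valuation F (μ' - y') < ρ → μ ≠ μ' := by
      intro μ μ' y y' hy hy' hne hμy hμ'y' heq
      subst heq
      have hlt : valuation F (y - y') < ρ :=
        valuation_sub_lt_of_lt_of_lt (by rw [Valuation.map_sub_swap]; exact hμy) (by rw [Valuation.map_sub_swap]; exact hμ'y')
      exact (lt_irrefl _) (hlt.trans_le (hρsep y hy y' hy' hne))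
    have h12 : μ₁ ≠ μ₂ := hsep' hx₁ hx₂ hnd.1 hμ₁x hμ₂x
    have h13 : μ₁ ≠ μ₃ := hsep' hx₁ hx₃ hnd.2.1 hμ₁x hμ₃x
    have h23 : μ₂ ≠ μ₃ := hsep' hx₂ hx₃ hnd.2.2 hμ₂x hμ₃x
    have hsub : ({μ₁, μ₂, μ₃} : Multiset F) ≤ Y.charpoly.roots := by
      refine (Multiset.le_iff_subset ?_).2 ?_
      · simp [Multiset.insert_eq_cons, h12, h13, h23]
      · intro μ hμ
        simp only [Multiset.insert_eq_cons, Multiset.mem_cons, Multiset.mem_singleton] at hμ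
        rcases hμ with rfl | rfl | rfl
        · exact (mem_roots (hY0 Y)).2 hμ₁
        · exact (mem_roots (hY0 Y)).2 hμ₂
        · exact (mem_roots (hY0 Y)).2 hμ₃
    have hT : ({μ₁, μ₂, μ₃} : Multiset F) = Y.charpoly.roots :=
      Multiset.eq_of_le_of_card_le hsub (by rw [hcard, hS3]; simp)
    rw [← hT, hS123]
    simp only [Multiset.insert_eq_cons, Multiset.map_cons, Multiset.map_singleton, h3 x₁ hx₁ μ₁ hμ₁x, h3 x₂ hx₂ μ₂ hμ₂x,
      h3 x₃ hx₃ μ₃ hμ₃x]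

/-- **The same with the normalised absolute value `‖·‖_F`** (`normAbs F` is a function of the valuation). [cite: HarishChandra1999AdmissibleDistributions, §7] -/
theorem eventually_map_normAbs_derivative_roots_charpoly_eq (X₀ : Matrix (Fin 3) (Fin 3) F) (hD : X₀.charpoly.discr ≠ 0) :
    ∀ᶠ Y in 𝓝 X₀, Y.charpoly.roots.map (fun μ => normAbs F (Y.charpoly.derivative.eval μ)) =
      X₀.charpoly.roots.map (fun x => normAbs F (X₀.charpoly.derivative.eval x)) := by
  filter_upwards [eventually_map_valuation_derivative_roots_charpoly_eq X₀ hD] with Y hY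
  have key : ∀ (p : F[X]), p.roots.map (fun μ => normAbs F (p.derivative.eval μ)) =
      (p.roots.map (fun μ => valuation F (p.derivative.eval μ))).map
        (fun γ => WithZeroMulInt.toNNReal (Nat.cast_ne_zero.mpr (residueFieldCard_ne_zero F))
          (_root_.IsNonarchimedeanLocalField.valueGroupWithZeroIsoInt F γ)) := by
    intro p
    rw [Multiset.map_map]
    rfl
  rw [key, key, hY]

/-- **The local constancy clause of `W_𝔭`**: near `X₀` (`disc χ_{X₀} ≠ 0`),
`Σ_{λ ∈ roots χ_Y} ‖χ_Y′(λ)‖_F⁻¹ = Σ_{λ ∈ roots χ_{X₀}} ‖χ_{X₀}′(λ)‖_F⁻¹` (real numbers; the sum over the multiset of rational roots).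
[cite: HarishChandra1999AdmissibleDistributions, §7] -/
theorem eventually_sum_inv_normAbs_derivative_roots_charpoly_eq (X₀ : Matrix (Fin 3) (Fin 3) F) (hD : X₀.charpoly.discr ≠ 0) :
    ∀ᶠ Y in 𝓝 X₀, (Y.charpoly.roots.map (fun μ => ((normAbs F (Y.charpoly.derivative.eval μ) : ℝ))⁻¹)).sum =
      (X₀.charpoly.roots.map (fun x => ((normAbs F (X₀.charpoly.derivative.eval x) : ℝ))⁻¹)).sum := by
  filter_upwards [eventually_map_normAbs_derivative_roots_charpoly_eq X₀ hD] with Y hY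
  have key : ∀ (p : F[X]), p.roots.map (fun μ => ((normAbs F (p.derivative.eval μ) : ℝ))⁻¹) =
      (p.roots.map (fun μ => normAbs F (p.derivative.eval μ))).map (fun r : ℝ≥0 => ((r : ℝ))⁻¹) := by
    intro p
    rw [Multiset.map_map]
    rfl
  rw [key, key, hY]

end Summit.HodgeConjecture.HodgeConjecture.Cruxes.H413.K2E3CubicRootDerivativeValuations

end
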